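import Summits.FinalStateConjecture.FinalStateConjecture.Theorems.PhotonSphereChannelsChannelsResolveTameDevelopmentsROutgoingEnergyExhaustion
import Summits.FinalStateConjecture.FinalStateConjecture.Theorems.PhotonSphereChannelsChannelsResolveTameDevelopmentsRTotalEnergyConservation

/-!
# Crux `WindowedShellChannels` (stmt-FinalStateConjecture-14085), line `Sketch` — piece S1
# `stub_compactRate`: compact-data windowed exhaustion with an explicit rate, one mode

For the Regge–Wheeler mode `(s, ℓ)`, `s ≤ 2`, `s ≤ ℓ`, on the centred unit-mass tortoise line (`M = 1`,
`r = tortoiseRadius one_pos 0`, photon sphere at `x = 0`, `V = linePotential 1 s ℓ r > 0`) there is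
`C₁ = C₁(s, ℓ) ≥ 0` such that every finite-energy global `C²` solution with Cauchy data supported in
`[−R, R]`, `R ≥ 1`, satisfies `E ≤ channelEnergy V 0 (−B) ψ atTop + (C₁ R / B) · E` for every lag `B > 0`.

This is the K2R chain `ILED ⇒ quadrant bounds ⇒ exhaustion` (`…ROutgoingEnergyExhaustion`) with explicit
constants: `CompactRate.quadrantBound_right_explicit / _left_explicit` are the proofs of
`RW.quadrantBound_right/left` (`…RCompactExhaustion`) with `Q = 12 (b + 1 − xc) E + A K`, resp.
`2 (xc + 1 − a) E + A K` — the weighted initial energies are at most `2 W E` for a weight `0 ≤ w ≤ W`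
(`CompactRate.weightedInitial_le`; `r − 3M ≤ x − xc` on `x ≥ xc` since `r' < 1`); the local `L²` bound
`K ≤ C_ILED E` is `RW.rwLocalEnergyDecay_fderiv` (`…RLocalEnergyDecay`); and
`CompactRate.totalEnergy_le_channelEnergy_neg_add` is the lower bound
`E ≤ channelEnergy V xc (−B) ψ atTop + ofReal ((Q_R + Q_L)/B)` behind
`RW.tendsto_channelEnergy_shift_of_quadrantBounds` (`…RExhaustion`), for the lagged aperture `−B` of the
unshifted solution.  No definitions; standard material. [folklore]
-/

noncomputable section

-- every `Summit.FinalStateConjecture.FinalStateConjecture.…` name repeats the summit = sub-problem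
-- segment (D-0017 layout), as in every landed `…Theorems` file of this route
set_option linter.dupNamespace false

namespace Summit.FinalStateConjecture.FinalStateConjecture.Theorems.WindowedShellChannelsSketch

open Literature.Geometry.Lorentzian Literature.Geometry.Lorentzian.ReggeWheeler Filter Set MeasureTheory
open scoped ENNReal Topology

namespace CompactRate

open intervalIntegral

variable {M : ℝ} {r : ℝ → ℝ} {xc : ℝ} {s ℓ : ℕ}

/-- The Morawetz weight `r − 3M` is non-negative to the right of the photon sphere. -/
theorem weight_nonneg (hr : IsTortoiseRadius M r xc) {x : ℝ} (hx : xc ≤ x) : 0 ≤ r x - 3 * M := by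
  have := hr.strictMono.monotone hx
  rw [hr.center] at this
  linarith

/-- The Morawetz weight `r − 3M` is dominated by `x − xc` to the right of the photon sphere
(`r(xc) = 3M`, `r' = 1 − 2M/r < 1`). -/
theorem weight_le (hr : IsTortoiseRadius M r xc) {x : ℝ} (hx : xc ≤ x) : r x - 3 * M ≤ x - xc := by
  have hanti : Antitone fun y ↦ r y - y := by
    refine antitone_of_deriv_nonpos (hr.differentiable.sub differentiable_id) fun y ↦ ?_
    rw [((hr.hasDerivAt y).fun_sub (hasDerivAt_id' y)).deriv]
    have : 0 < 2 * M / r y := div_pos (by linarith [hr.mass_pos]) (hr.pos y)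
    linarith
  have h := hanti hx
  simp only [hr.center] at h
  linarith

/-- `(ψ_t + κψ_x)² + Vψ² ≤ 2 e` pointwise for `κ² = 1`, `V ≥ 0` (real numbers). -/
theorem null_le_two_mul {p q v u κ : ℝ} (hκ : κ ^ 2 = 1) (hv : 0 ≤ v) :
    (p + κ * q) ^ 2 + v * u ^ 2 ≤ 2 * (p ^ 2 + q ^ 2 + v * u ^ 2) := by
  nlinarith [sq_nonneg (p - κ * q), mul_nonneg hv (sq_nonneg u)]

/-- **Weighted initial null energies are controlled by the total energy.** For `V ≥ 0` differentiable,
a global `C²` solution with Cauchy data supported in `[a, b]`, `κ² = 1` and a continuous weight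
`0 ≤ w ≤ W` on `[p, q] ⊆ [a − 1, b + 1]`:
`∫_p^q w · ((ψ_t + κψ_x)² + Vψ²)(0, ·) ≤ 2 W E`. [folklore] -/
theorem weightedInitial_le {V : ℝ → ℝ} {ψ : ℝ → ℝ → ℝ} (hV : Differentiable ℝ V) (hV0 : ∀ x, 0 ≤ V x)
    (hψ : IsSolution V ψ) {a b : ℝ} (hdata : CauchyDataSupportedOn ψ (Icc a b)) {κ : ℝ}
    (hκ : κ ^ 2 = 1) {w : ℝ → ℝ} (hw : Continuous w) {p q W : ℝ} (hap : a - 1 ≤ p) (hpq : p ≤ q)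
    (hqb : q ≤ b + 1) (hw0 : ∀ x ∈ Icc p q, 0 ≤ w x) (hwW : ∀ x ∈ Icc p q, w x ≤ W) :
    (∫ x in p..q, w x * ((fderiv ℝ (Function.uncurry ψ) (0, x) (1, 0)
        + κ * fderiv ℝ (Function.uncurry ψ) (0, x) (0, 1)) ^ 2
        + V x * Function.uncurry ψ (0, x) ^ 2)) ≤ 2 * (W * (totalEnergy V ψ 0).toReal) := by
  have hU := hψ.1
  have hdata' : CauchyDataSupportedOn ψ (Ioo (a - 1) (b + 1)) := fun x hx ↦
    hdata x fun h ↦ hx ⟨by linarith [h.1], by linarith [h.2]⟩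
  obtain ⟨hE0, hEeq, hEle⟩ := RW.integral_energy_le_initial hV hV0 hψ (by linarith) hdata'
  have hec : Continuous fun x ↦ energyDensity V ψ 0 x := RW.continuous_energyDensity_slice hV hU 0
  have he1c := (RW.continuous_inwardDensity hV hU κ).comp (Continuous.prodMk_right (0 : ℝ))
  have hW : 0 ≤ W := (hw0 p ⟨le_rfl, hpq⟩).trans (hwW p ⟨le_rfl, hpq⟩)
  have h1 : (∫ x in p..q, w x * ((fderiv ℝ (Function.uncurry ψ) (0, x) (1, 0)
      + κ * fderiv ℝ (Function.uncurry ψ) (0, x) (0, 1)) ^ 2 + V x * Function.uncurry ψ (0, x) ^ 2))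
      ≤ ∫ x in p..q, 2 * W * energyDensity V ψ 0 x := by
    refine intervalIntegral.integral_mono_on hpq ((hw.mul he1c).intervalIntegrable _ _)
      ((hec.const_mul _).intervalIntegrable _ _) fun x hx ↦ ?_
    have hex : (fderiv ℝ (Function.uncurry ψ) (0, x) (1, 0)
        + κ * fderiv ℝ (Function.uncurry ψ) (0, x) (0, 1)) ^ 2 + V x * Function.uncurry ψ (0, x) ^ 2
        ≤ 2 * energyDensity V ψ 0 x := by
      rw [RW.energyDensity_eq_fderiv hU]
      exact null_le_two_mul hκ (hV0 x)
    calc _ ≤ W * (2 * energyDensity V ψ 0 x) :=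
          mul_le_mul (hwW x hx) hex (by have := hV0 x; positivity) hW
      _ = 2 * W * energyDensity V ψ 0 x := by ring
  rw [intervalIntegral.integral_const_mul] at h1
  have h2 := mul_le_mul_of_nonneg_left (hEle 0 p q hpq) hW
  rw [hEeq, ENNReal.toReal_ofReal hE0]
  linarith

/-- **Right quadrant bound, explicit constant.** Along a tortoise radius function (`s ≤ 2`, `s ≤ ℓ`)
there are `ρ > 0` and `A ≥ 0` such that for every global `C²` Regge–Wheeler solution with Cauchy data
supported in `[a, b] ∋ xc` whose local `L²` mass on `[0, T] × [xc − ρ, xc + ρ]` is bounded by `K`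
uniformly in `T ≥ 0`, the space-time integral of `(ψ_t + ψ_x)² + Vψ²` over `[0, T] × [xc, R]` is at most
`12 (b + 1 − xc) E + A K` for all `T ≥ 0`, `R ≥ xc` (the proof of `RW.quadrantBound_right`, weight
`r − 3M ≤ b + 1 − xc` on `[xc, b + 1]`). [folklore] -/
theorem quadrantBound_right_explicit (hr : IsTortoiseRadius M r xc) (hs : s ≤ 2) (hsℓ : s ≤ ℓ) :
    ∃ ρ : ℝ, 0 < ρ ∧ ∃ A : ℝ, 0 ≤ A ∧ ∀ ψ : ℝ → ℝ → ℝ, IsRWSolution M s ℓ r ψ → ∀ a b : ℝ, a ≤ xc →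
      xc ≤ b → CauchyDataSupportedOn ψ (Icc a b) → ∀ K : ℝ,
      (∀ T, 0 ≤ T → (∫ t in (0 : ℝ)..T, ∫ x in (xc - ρ)..(xc + ρ), ψ t x ^ 2) ≤ K) →
      ∀ T, 0 ≤ T → ∀ R, xc ≤ R → (∫ t in (0 : ℝ)..T, ∫ x in xc..R,
        ((fderiv ℝ (Function.uncurry ψ) (t, x) (1, 0)
            + 1 * fderiv ℝ (Function.uncurry ψ) (t, x) (0, 1)) ^ 2
          + linePotential M s ℓ r x * Function.uncurry ψ (t, x) ^ 2))
        ≤ 12 * (b + 1 - xc) * (totalEnergy (linePotential M s ℓ r) ψ 0).toReal + A * K := by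
  have hM := hr.mass_pos
  obtain ⟨x₁, C, hx₁, hC, hfar, hnear⟩ := RW.linePotential_repulsive_right hr hs hsℓ
  set V := linePotential M s ℓ r with hV
  have hV1 : ContDiff ℝ 1 V := RW.contDiff_one_linePotential hr s ℓ
  have hVd : Differentiable ℝ V := RW.differentiable_linePotential hr s ℓ
  have hV0 : ∀ x, 0 ≤ V x := fun x ↦ (RW.linePotential_pos hr hsℓ x).le
  obtain ⟨V₁, hV₁⟩ := isCompact_Icc.exists_bound_of_continuousOn (s := Icc xc x₁)
    hVd.continuous.continuousOn
  have hV₁' : ∀ x ∈ Icc xc x₁, V x ≤ V₁ := fun x hx ↦ (le_abs_self _).trans (hV₁ x hx)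
  have hV₁0 : 0 ≤ V₁ := (norm_nonneg _).trans (hV₁ xc ⟨le_rfl, by linarith⟩)
  refine ⟨x₁ - xc, by linarith, 6 * C + V₁, by positivity,
    fun ψ hψ a b ha hb hdata K hK T hT R hR ↦ ?_⟩
  have hdata' : CauchyDataSupportedOn ψ (Ioo (a - 1) (b + 1)) := fun x hx ↦
    hdata x fun h ↦ hx ⟨by linarith [h.1], by linarith [h.2]⟩
  have hzero := fun (τ y : ℝ) (hy : b + 1 + |τ| ≤ y) (v : ℝ × ℝ) ↦
    RW.eq_zero_outside_cone hVd hV0 hψ hdata' (Or.inl hy) v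
  have hsol := RW.IsSolution.fderiv_eq hψ
  -- the weighted initial energy is at most `2 (b + 1 - xc) E`
  have hEw0le := weightedInitial_le hVd hV0 hψ hdata (κ := 1) (by norm_num) (w := fun x ↦ r x - 3 * M)
    (hr.continuous.fun_sub continuous_const) (p := xc) (q := b + 1) (W := b + 1 - xc) (by linarith)
    (by linarith) le_rfl (fun x hx ↦ weight_nonneg hr hx.1)
    (fun x hx ↦ (weight_le hr hx.1).trans (by linarith [hx.2]))
  set U := Function.uncurry ψ with hUdef
  have hU : ContDiff ℝ 2 U := hψ.1
  set e1 : ℝ × ℝ → ℝ := fun z ↦ (fderiv ℝ U z (1, 0) + 1 * fderiv ℝ U z (0, 1)) ^ 2 + V z.2 * U z ^ 2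
    with he1
  set p1 : ℝ × ℝ → ℝ := fun z ↦ 1 * ((fderiv ℝ U z (1, 0) + 1 * fderiv ℝ U z (0, 1)) ^ 2
    - V z.2 * U z ^ 2) with hp1
  have he1c : Continuous e1 := RW.continuous_inwardDensity hVd hU 1
  have he10 : ∀ z, 0 ≤ e1 z := fun z ↦ by have := hV0 z.2; positivity
  have hw : ∀ x, HasDerivAt (fun x ↦ r x - 3 * M) (1 - 2 * M / r x) x := fun x ↦
    (hr.hasDerivAt x).sub_const _
  have hw' : Continuous fun x ↦ 1 - 2 * M / r x :=
    continuous_const.sub (continuous_const.div hr.continuous fun x ↦ (hr.pos x).ne')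
  -- the local `L²` bound on `[xc, x₁]`
  have hK' : ∀ T, 0 ≤ T → (∫ t in (0 : ℝ)..T, ∫ x in xc..x₁, U (t, x) ^ 2) ≤ K := by
    intro T hT
    have h := hK T hT
    rw [show xc + (x₁ - xc) = x₁ by ring] at h
    exact (WaveEnergy.integral2_mono_left (g := fun z ↦ U z ^ 2) (hU.continuous.pow 2)
      (fun z ↦ sq_nonneg _) hT (by linarith) (by linarith)).trans h
  set Ew0 : ℝ := ∫ x in xc..(b + 1), (r x - 3 * M) * e1 (0, x) with hEw0
  have hi : ∀ p q, IntervalIntegrable (fun x ↦ (r x - 3 * M) * e1 (0, x)) volume p q := fun p q ↦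
    ((hr.continuous.sub continuous_const).mul (he1c.comp (Continuous.prodMk_right 0))).intervalIntegrable _ _
  set R' : ℝ := max R (max x₁ (b + 1 + T)) with hR'
  have hRR' : R ≤ R' := le_max_left _ _
  have hx₁R' : x₁ ≤ R' := (le_max_left _ _).trans (le_max_right _ _)
  have hbR' : b + 1 + T ≤ R' := (le_max_right _ _).trans (le_max_right _ _)
  -- enlarge the box to `[xc, R']`
  refine (WaveEnergy.integral2_mono_right (g := e1) he1c he10 hT hR hRR').trans ?_
  -- the identity with vanishing boundary terms
  have hid := WaveEnergy.weighted_identity_box (κ := 1) hU hV1 (by norm_num) hsol (eκ := e1) (pκ := p1)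
    (fun _ ↦ rfl) (fun _ ↦ rfl) hw hw' xc R' 0 T
  have hbdry : (∫ t in (0 : ℝ)..T, ((r R' - 3 * M) * p1 (t, R') - (r xc - 3 * M) * p1 (t, xc))) = 0 := by
    rw [intervalIntegral.integral_congr (g := fun _ ↦ (0 : ℝ)) fun t ht ↦ ?_]
    · simp
    · rw [uIcc_of_le hT] at ht
      have hy : b + 1 + |t| ≤ R' := by rw [abs_of_nonneg ht.1]; linarith [ht.2]
      simp only [hp1, hr.center, (hzero t R' hy (1, 0)).1, (hzero t R' hy (1, 0)).2,
        (hzero t R' hy (0, 1)).2]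
      ring
  rw [hbdry, zero_add] at hid
  -- the weighted initial energy on `[xc, R']` is `Ew0`
  have hEw : (∫ x in xc..R', (r x - 3 * M) * e1 (0, x)) = Ew0 := by
    rw [hEw0, ← intervalIntegral.integral_add_adjacent_intervals (hi xc (b + 1)) (hi (b + 1) R'),
      intervalIntegral.integral_congr (a := b + 1) (b := R') (g := fun _ ↦ (0 : ℝ)) fun x hx ↦ ?_]
    · simp
    · rw [uIcc_of_le (by linarith)] at hx
      have hy : b + 1 + |(0 : ℝ)| ≤ x := by rw [abs_zero, add_zero]; exact hx.1
      simp only [he1, (hzero 0 x hy (1, 0)).1, (hzero 0 x hy (1, 0)).2, (hzero 0 x hy (0, 1)).2]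
      ring
  refine (WaveEnergy.weighted_box_estimate_Ioo (κ := 1) (c := 1 / 6) hU hV1 hV0 (fun _ ↦ rfl) hw hw'
    le_rfl (by linarith) hx₁R' hT hid (fun x hx ↦ weight_nonneg hr hx.1) (by norm_num)
    (fun x hx ↦ ?_) (fun x hx ↦ ?_) hC (fun x hx ↦ hnear x ⟨hx.1.le, hx.2.le⟩) hV₁' (hK' T hT)).trans ?_
  · have h3 : 3 * M ≤ r x := by linarith [weight_nonneg hr hx.1]
    have : 2 * M / r x ≤ 2 / 3 := by rw [div_le_iff₀ (hr.pos x)]; linarith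
    linarith
  · rcases hx with hx | hx
    · exact absurd hx.1 (not_lt.2 hx.2.le)
    · exact hfar x hx.1
  · rw [hEw, show (Ew0 + (C + 1 / 6 * V₁) * K) / (1 / 6) = 6 * Ew0 + (6 * C + V₁) * K by ring]
    linarith

/-- **Left quadrant bound, explicit constant.** The horizon-side analogue of
`quadrantBound_right_explicit` for the outgoing null energy `(ψ_t − ψ_x)² + Vψ²` over `[0, T] × [L, xc]`
(the proof of `RW.quadrantBound_left`, weight `xc − x ≤ xc + 1 − a` on `[a − 1, xc]`): the bound is
`2 (xc + 1 − a) E + A K`. [folklore] -/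
theorem quadrantBound_left_explicit (hr : IsTortoiseRadius M r xc) (hs : s ≤ 2) (hsℓ : s ≤ ℓ) :
    ∃ ρ : ℝ, 0 < ρ ∧ ∃ A : ℝ, 0 ≤ A ∧ ∀ ψ : ℝ → ℝ → ℝ, IsRWSolution M s ℓ r ψ → ∀ a b : ℝ, a ≤ xc →
      xc ≤ b → CauchyDataSupportedOn ψ (Icc a b) → ∀ K : ℝ,
      (∀ T, 0 ≤ T → (∫ t in (0 : ℝ)..T, ∫ x in (xc - ρ)..(xc + ρ), ψ t x ^ 2) ≤ K) →
      ∀ T, 0 ≤ T → ∀ L, L ≤ xc → (∫ t in (0 : ℝ)..T, ∫ x in L..xc,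
        ((fderiv ℝ (Function.uncurry ψ) (t, x) (1, 0)
            + (-1) * fderiv ℝ (Function.uncurry ψ) (t, x) (0, 1)) ^ 2
          + linePotential M s ℓ r x * Function.uncurry ψ (t, x) ^ 2))
        ≤ 2 * (xc + 1 - a) * (totalEnergy (linePotential M s ℓ r) ψ 0).toReal + A * K := by
  obtain ⟨x₀, C, hx₀, hC, hfar, hnear⟩ := RW.linePotential_repulsive_left hr hs hsℓ
  set V := linePotential M s ℓ r with hV
  have hV1 : ContDiff ℝ 1 V := RW.contDiff_one_linePotential hr s ℓ
  have hVd : Differentiable ℝ V := RW.differentiable_linePotential hr s ℓ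
  have hV0 : ∀ x, 0 ≤ V x := fun x ↦ (RW.linePotential_pos hr hsℓ x).le
  obtain ⟨V₁, hV₁⟩ := isCompact_Icc.exists_bound_of_continuousOn (s := Icc x₀ xc)
    hVd.continuous.continuousOn
  have hV₁' : ∀ x ∈ Icc x₀ xc, V x ≤ V₁ := fun x hx ↦ (le_abs_self _).trans (hV₁ x hx)
  have hV₁0 : 0 ≤ V₁ := (norm_nonneg _).trans (hV₁ xc ⟨by linarith, le_rfl⟩)
  refine ⟨xc - x₀, by linarith, C + V₁, by positivity, fun ψ hψ a b ha hb hdata K hK T hT L hL ↦ ?_⟩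
  have hdata' : CauchyDataSupportedOn ψ (Ioo (a - 1) (b + 1)) := fun x hx ↦
    hdata x fun h ↦ hx ⟨by linarith [h.1], by linarith [h.2]⟩
  have hzero := fun (τ y : ℝ) (hy : y ≤ a - 1 - |τ|) (v : ℝ × ℝ) ↦
    RW.eq_zero_outside_cone hVd hV0 hψ hdata' (Or.inr hy) v
  have hsol := RW.IsSolution.fderiv_eq hψ
  -- the weighted initial energy is at most `2 (xc + 1 - a) E`
  have hEw0le := weightedInitial_le hVd hV0 hψ hdata (κ := -1) (by norm_num) (w := fun x ↦ xc - x)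
    (continuous_const.fun_sub continuous_id') (p := a - 1) (q := xc) (W := xc + 1 - a) le_rfl
    (by linarith) (by linarith) (fun x hx ↦ by linarith [hx.2]) (fun x hx ↦ by linarith [hx.1])
  set U := Function.uncurry ψ with hUdef
  have hU : ContDiff ℝ 2 U := hψ.1
  set e1 : ℝ × ℝ → ℝ := fun z ↦ (fderiv ℝ U z (1, 0) + (-1) * fderiv ℝ U z (0, 1)) ^ 2 + V z.2 * U z ^ 2
    with he1
  set p1 : ℝ × ℝ → ℝ := fun z ↦ (-1) * ((fderiv ℝ U z (1, 0) + (-1) * fderiv ℝ U z (0, 1)) ^ 2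
    - V z.2 * U z ^ 2) with hp1
  have he1c : Continuous e1 := RW.continuous_inwardDensity hVd hU (-1)
  have he10 : ∀ z, 0 ≤ e1 z := fun z ↦ by have := hV0 z.2; positivity
  have hw : ∀ x, HasDerivAt (fun x ↦ xc - x) (-1) x := fun x ↦ (hasDerivAt_id' x).const_sub xc
  have hw' : Continuous fun _ : ℝ ↦ (-1 : ℝ) := continuous_const
  -- the local `L²` bound on `[x₀, xc]`
  have hK' : ∀ T, 0 ≤ T → (∫ t in (0 : ℝ)..T, ∫ x in x₀..xc, U (t, x) ^ 2) ≤ K := by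
    intro T hT
    have h := hK T hT
    rw [show xc - (xc - x₀) = x₀ by ring] at h
    exact (WaveEnergy.integral2_mono_right (g := fun z ↦ U z ^ 2) (hU.continuous.pow 2)
      (fun z ↦ sq_nonneg _) hT (by linarith) (by linarith)).trans h
  set Ew0 : ℝ := ∫ x in (a - 1)..xc, (xc - x) * e1 (0, x) with hEw0
  have hi : ∀ p q, IntervalIntegrable (fun x ↦ (xc - x) * e1 (0, x)) volume p q := fun p q ↦
    ((continuous_const.sub continuous_id).mul (he1c.comp (Continuous.prodMk_right 0))).intervalIntegrable _ _
  set L' : ℝ := min L (min x₀ (a - 1 - T)) with hL'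
  have hLL' : L' ≤ L := min_le_left _ _
  have hx₀L' : L' ≤ x₀ := (min_le_right _ _).trans (min_le_left _ _)
  have haL' : L' ≤ a - 1 - T := (min_le_right _ _).trans (min_le_right _ _)
  -- enlarge the box to `[L', xc]`
  refine (WaveEnergy.integral2_mono_left (g := e1) he1c he10 hT hLL' hL).trans ?_
  -- the identity with vanishing boundary terms
  have hid := WaveEnergy.weighted_identity_box (κ := -1) hU hV1 (by norm_num) hsol (eκ := e1) (pκ := p1)
    (fun _ ↦ rfl) (fun _ ↦ rfl) hw hw' L' xc 0 T
  have hbdry : (∫ t in (0 : ℝ)..T, ((xc - xc) * p1 (t, xc) - (xc - L') * p1 (t, L'))) = 0 := by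
    rw [intervalIntegral.integral_congr (g := fun _ ↦ (0 : ℝ)) fun t ht ↦ ?_]
    · simp
    · rw [uIcc_of_le hT] at ht
      have hy : L' ≤ a - 1 - |t| := by rw [abs_of_nonneg ht.1]; linarith [ht.2]
      simp only [hp1, sub_self, (hzero t L' hy (1, 0)).1, (hzero t L' hy (1, 0)).2,
        (hzero t L' hy (0, 1)).2]
      ring
  rw [hbdry, zero_add] at hid
  -- the weighted initial energy on `[L', xc]` is `Ew0`
  have hEw : (∫ x in L'..xc, (xc - x) * e1 (0, x)) = Ew0 := by
    rw [hEw0, ← intervalIntegral.integral_add_adjacent_intervals (hi L' (a - 1)) (hi (a - 1) xc),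
      intervalIntegral.integral_congr (a := L') (b := a - 1) (g := fun _ ↦ (0 : ℝ)) fun x hx ↦ ?_]
    · simp
    · rw [uIcc_of_le (by linarith)] at hx
      have hy : x ≤ a - 1 - |(0 : ℝ)| := by rw [abs_zero, sub_zero]; exact hx.2
      simp only [he1, (hzero 0 x hy (1, 0)).1, (hzero 0 x hy (1, 0)).2, (hzero 0 x hy (0, 1)).2]
      ring
  refine (WaveEnergy.weighted_box_estimate_Ioo (κ := -1) (c := 1) hU hV1 hV0 (fun _ ↦ rfl) hw hw' hx₀L'
    (by linarith) le_rfl hT hid (fun x hx ↦ ?_) (by norm_num) (fun x _ ↦ by norm_num) (fun x hx ↦ ?_)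
    hC (fun x hx ↦ hnear x ⟨hx.1.le, hx.2.le⟩) hV₁' (hK' T hT)).trans ?_
  · linarith [hx.2]
  · rcases hx with hx | hx
    · exact hfar x hx.2
    · exact absurd hx.1 (not_lt.2 hx.2.le)
  · rw [hEw, show (Ew0 + (C + 1 * V₁) * K) / 1 = Ew0 + (C + V₁) * K by ring]
    linarith

/-- The local `L²` mass is dominated by the integrated-local-energy-decay integrand `u_t² + u_x² + u²`
on every box (`0 ≤ T`, `p ≤ q`). -/
theorem integral2_sq_le {ψ : ℝ → ℝ → ℝ} (hU : ContDiff ℝ 2 (Function.uncurry ψ)) {T p q : ℝ}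
    (hT : 0 ≤ T) (hpq : p ≤ q) :
    (∫ t in (0 : ℝ)..T, ∫ x in p..q, ψ t x ^ 2) ≤ ∫ t in (0 : ℝ)..T, ∫ x in p..q,
      (fderiv ℝ (Function.uncurry ψ) (t, x) (1, 0) ^ 2
        + fderiv ℝ (Function.uncurry ψ) (t, x) (0, 1) ^ 2 + Function.uncurry ψ (t, x) ^ 2) :=
  WaveEnergy.integral2_mono_on_Ioo (g := fun z : ℝ × ℝ ↦ ψ z.1 z.2 ^ 2)
    (h := fun z : ℝ × ℝ ↦ fderiv ℝ (Function.uncurry ψ) z (1, 0) ^ 2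
      + fderiv ℝ (Function.uncurry ψ) z (0, 1) ^ 2 + Function.uncurry ψ z ^ 2)
    (hU.continuous.pow 2)
    ((((WaveEnergy.continuous_fderiv_apply hU (1, 0)).pow 2).add
      ((WaveEnergy.continuous_fderiv_apply hU (0, 1)).pow 2)).add (hU.continuous.pow 2))
    hT hpq fun t _ x _ ↦ le_add_of_nonneg_left (by positivity)

/-- **The lagged forward channel catches all but `(Q_R + Q_L)/B` of the energy.** For `V ≥ 0`
differentiable, a global `C²` solution with quadrant bounds `Q_R`, `Q_L` about `xc` (as in
`RW.mul_coneInterior_le_of_quadrantBounds`) and a lag `B > 0`: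
`E ≤ channelEnergy V xc (−B) ψ atTop + ofReal ((Q_R + Q_L)/B)` — for `t ≥ B` the exterior set
`{−B + |t| < |x − xc|}` is the bare exterior set of the shifted solution `ψ(B + ·)` at time `t − B`, whose
complement carries at most `(Q_R + Q_L)/B` (`RW.totalEnergy_eq_exteriorEnergy_shift_add`). [folklore] -/
theorem totalEnergy_le_channelEnergy_neg_add {V : ℝ → ℝ} {ψ : ℝ → ℝ → ℝ} (hV : Differentiable ℝ V)
    (hV0 : ∀ x, 0 ≤ V x) (hψ : IsSolution V ψ) {xc QR QL : ℝ}
    (hQR : ∀ T, 0 ≤ T → ∀ R, xc ≤ R → (∫ t in (0 : ℝ)..T, ∫ x in xc..R,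
      ((fderiv ℝ (Function.uncurry ψ) (t, x) (1, 0) + 1 * fderiv ℝ (Function.uncurry ψ) (t, x) (0, 1)) ^ 2
        + V x * Function.uncurry ψ (t, x) ^ 2)) ≤ QR)
    (hQL : ∀ T, 0 ≤ T → ∀ L, L ≤ xc → (∫ t in (0 : ℝ)..T, ∫ x in L..xc,
      ((fderiv ℝ (Function.uncurry ψ) (t, x) (1, 0) + (-1) * fderiv ℝ (Function.uncurry ψ) (t, x) (0, 1)) ^ 2
        + V x * Function.uncurry ψ (t, x) ^ 2)) ≤ QL)
    {B : ℝ} (hB : 0 < B) :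
    totalEnergy V ψ 0 ≤ channelEnergy V xc (-B) ψ atTop + ENNReal.ofReal ((QR + QL) / B) := by
  have key : ∀ t, B ≤ t →
      totalEnergy V ψ 0 ≤ exteriorEnergy V xc (-B) ψ t + ENNReal.ofReal ((QR + QL) / B) := by
    intro t ht
    have hτ : 0 ≤ t - B := sub_nonneg.2 ht
    have hext : exteriorEnergy V xc 0 (fun s y ↦ ψ (B + s) y) (t - B) = exteriorEnergy V xc (-B) ψ t := by
      unfold exteriorEnergy
      have hset : {x : ℝ | 0 + |t - B| < |x - xc|} = {x : ℝ | -B + |t| < |x - xc|} := by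
        ext x
        simp only [mem_setOf_eq]
        rw [abs_of_nonneg hτ, abs_of_nonneg (hB.le.trans ht)]
        constructor <;> intro h <;> linarith
      rw [hset]
      refine lintegral_congr fun x ↦ ?_
      rw [RW.energyDensity_shift, show B + (t - B) = t by ring]
    rw [RW.totalEnergy_eq_exteriorEnergy_shift_add hV hV0 hψ xc B hτ, hext]
    gcongr
    rw [le_div_iff₀ hB, mul_comm]
    exact RW.mul_coneInterior_le_of_quadrantBounds hV hV0 hψ hQR hQL hB hτ
  unfold channelEnergy
  refine tsub_le_iff_right.1 (Filter.le_liminf_of_le (by isBoundedDefault) ?_)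
  filter_upwards [eventually_ge_atTop B] with t ht using tsub_le_iff_right.2 (key t ht)

end CompactRate

/-- **Registered piece S1 `stub_compactRate` of line `Sketch`** (crux stmt-FinalStateConjecture-14085):
compact-data windowed exhaustion with an explicit rate, one mode.  There is `C₁ = C₁(s, ℓ) ≥ 0` such that
every finite-energy global `C²` Regge–Wheeler solution (`M = 1`, centred tortoise line, `s ≤ 2`, `s ≤ ℓ`)
with Cauchy data supported in `[−R, R]`, `R ≥ 1`, radiates all but `C₁ R / B` of its energy ahead of the
forward cone of lag `B > 0` about the photon sphere:
`E ≤ channelEnergy V 0 (−B) ψ atTop + (C₁ R / B) · E`.  Explicit K2R chain: the explicit quadrant bounds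
(`CompactRate.quadrantBound_right_explicit / _left_explicit`) fed with the uniform local `L²` bound of
`RW.rwLocalEnergyDecay_fderiv`, then `CompactRate.totalEnergy_le_channelEnergy_neg_add`;
`C₁ = 28 + A_R C_R + A_L C_L`. [folklore] -/
theorem stub_compactRate (s ℓ : ℕ) (hs : s ≤ 2) (hsℓ : s ≤ ℓ) : ∃ C₁ : ℝ, 0 ≤ C₁ ∧ ∀ R : ℝ, 1 ≤ R →
    ∀ ψ : ℝ → ℝ → ℝ, IsRWSolution 1 s ℓ (tortoiseRadius one_pos 0) ψ → CauchyDataSupportedOn ψ (Icc (-R) R) →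
      totalEnergy (linePotential 1 s ℓ (tortoiseRadius one_pos 0)) ψ 0 ≠ ⊤ → ∀ B : ℝ, 0 < B →
        totalEnergy (linePotential 1 s ℓ (tortoiseRadius one_pos 0)) ψ 0 ≤
          channelEnergy (linePotential 1 s ℓ (tortoiseRadius one_pos 0)) 0 (-B) ψ atTop + ENNReal.ofReal (C₁ * R / B) * totalEnergy (linePotential 1 s ℓ (tortoiseRadius one_pos 0)) ψ 0 := by
  have hr : IsTortoiseRadius 1 (tortoiseRadius one_pos 0) 0 := isTortoiseRadius_tortoiseRadius one_pos 0
  obtain ⟨ρR, hρR, AR, hAR, HR⟩ := CompactRate.quadrantBound_right_explicit hr hs hsℓ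
  obtain ⟨ρL, hρL, AL, hAL, HL⟩ := CompactRate.quadrantBound_left_explicit hr hs hsℓ
  obtain ⟨CR, hCR, hIR⟩ := RW.rwLocalEnergyDecay_fderiv hr hs hsℓ hρR
  obtain ⟨CL, hCL, hIL⟩ := RW.rwLocalEnergyDecay_fderiv hr hs hsℓ hρL
  refine ⟨24 + AR * CR + (4 + AL * CL), by positivity, fun R hR ψ hψ hdata hE B hB ↦ ?_⟩
  have hVd : Differentiable ℝ (linePotential 1 s ℓ (tortoiseRadius one_pos 0)) :=
    RW.differentiable_linePotential hr s ℓ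
  have hV0 : ∀ x, 0 ≤ linePotential 1 s ℓ (tortoiseRadius one_pos 0) x := fun x ↦
    (RW.linePotential_pos hr hsℓ x).le
  -- the uniform local `L²` bounds (ILED)
  have hKR : ∀ T, 0 ≤ T → (∫ t in (0 : ℝ)..T, ∫ x in (0 - ρR)..(0 + ρR), ψ t x ^ 2)
      ≤ CR * (totalEnergy (linePotential 1 s ℓ (tortoiseRadius one_pos 0)) ψ 0).toReal := fun T hT ↦
    (CompactRate.integral2_sq_le hψ.1 hT (by linarith)).trans (hIR ψ hψ ⟨_, _, hdata⟩ T hT)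
  have hKL : ∀ T, 0 ≤ T → (∫ t in (0 : ℝ)..T, ∫ x in (0 - ρL)..(0 + ρL), ψ t x ^ 2)
      ≤ CL * (totalEnergy (linePotential 1 s ℓ (tortoiseRadius one_pos 0)) ψ 0).toReal := fun T hT ↦
    (CompactRate.integral2_sq_le hψ.1 hT (by linarith)).trans (hIL ψ hψ ⟨_, _, hdata⟩ T hT)
  -- the explicit quadrant bounds and the lagged-channel lower bound
  have hQR := HR ψ hψ (-R) R (by linarith) (by linarith) hdata _ hKR
  have hQL := HL ψ hψ (-R) R (by linarith) (by linarith) hdata _ hKL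
  refine (CompactRate.totalEnergy_le_channelEnergy_neg_add hVd hV0 hψ hQR hQL hB).trans
    (add_le_add le_rfl ?_)
  -- arithmetic: `(Q_R + Q_L)/B ≤ (C₁ R / B) E`
  have hnum : ∀ {E' : ℝ}, 0 ≤ E' →
      (12 * (R + 1 - 0) * E' + AR * (CR * E') + (2 * (0 + 1 - -R) * E' + AL * (CL * E'))) / B
        ≤ (24 + AR * CR + (4 + AL * CL)) * R / B * E' := by
    intro E' hE'
    rw [div_mul_eq_mul_div]
    refine div_le_div_of_nonneg_right ?_ hB.le
    have h1 : 0 ≤ (R - 1) * E' := mul_nonneg (by linarith) hE'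
    have h2 : 0 ≤ AR * CR * ((R - 1) * E') := mul_nonneg (mul_nonneg hAR hCR) h1
    have h3 : 0 ≤ AL * CL * ((R - 1) * E') := mul_nonneg (mul_nonneg hAL hCL) h1
    linarith
  refine (ENNReal.ofReal_le_ofReal (hnum ENNReal.toReal_nonneg)).trans_eq ?_
  rw [ENNReal.ofReal_mul (by positivity), ENNReal.ofReal_toReal hE]

end Summit.FinalStateConjecture.FinalStateConjecture.Theorems.WindowedShellChannelsSketch

end
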